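/-
Copyright (c) 2026 the pub-hodgecm-mathlib formalisation cell (harness21).  Prover seat hodgecm-mathlib-K2Liu-p07 (g0),
Track B «K2-LIT» ∕ hLiu418 #184♮, unit U5 «DOUBLING ZETA INTEGRAL: CONVERGENCE INPUTS» of the K2_Liu road, file #14b:
matrix coefficients on the automorphic quotient are bounded by the `L²` norms (Cauchy–Schwarz).  2026-09-03.
-/
import Literature.NumberTheory.K2Lit.DoublingZetaIntegral
import Mathlib.MeasureTheory.Integral.MeanInequalities          -- `ENNReal.lintegral_mul_le_Lp_mul_Lq`
import Mathlib.MeasureTheory.Integral.Bochner.Basic             -- `enorm_integral_le_lintegral_enorm`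
import Mathlib.MeasureTheory.Group.Action                       -- `measurePreserving_smul`
import Mathlib.MeasureTheory.Group.MeasurableEquiv              -- `MeasurableEquiv.smul`
import Mathlib.MeasureTheory.Constructions.BorelSpace.Basic     -- `ContinuousConstSMul.toMeasurableConstSMul`
import Mathlib.Analysis.Complex.Basic                           -- `Complex.continuous_conj`
import HarnessLib

/-!
# K2_Liu road (hLiu418 = stmt-HodgeConjecture-24832), unit U5, file #14b:
# `‖⟨π(g)φ₁, φ₂⟩‖ ≤ ‖φ₁‖₂ · ‖φ₂‖₂` on the automorphic quotient

Cell `pub/hodgecm-mathlib` (D-0151), Track B (21-frontier RULING «PUSH BOTH» 2026-09-03, director req621∕req624,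
LEAD F0P6-plan «M-154j»), socket module
`Summits/HodgeConjecture/HodgeConjecture/Cruxes/HLiu418/Lines/K2_Liu_CurveThetaSigs_U5_DoublingZeta.lean` (planner K2Liu-plan
(g0)), socket #14b «`sig_K2LiuQuotMatrixCoeffBound`»: for `𝒢 : AdelicGroupData K`, an automorphic measure `μ` on
`[G] = G(𝔸) ⧸ A_G G(K)` (★ `IsAutomorphicMeasure`: finite, `G(𝔸)`-invariant, Borel) and the matrix coefficient
★ `quotMatrixCoeff 𝒢 μ φ₁ φ₂ g = ∫ φ₁(g⁻¹ • x) · conj(φ₂ x) dμ(x)`:  `‖⟨π(g)φ₁, φ₂⟩‖ₑ ≤ ‖φ₁‖_{L²(μ)} · ‖φ₂‖_{L²(μ)}`.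

THE MATHEMATICS AND ONE CORRECTION.  Cauchy–Schwarz plus `∫ |φ₁(g⁻¹ • x)|² dμ = ∫ |φ₁|² dμ` — but for the
statement to be TRUE in Mathlib's currency at least one of `φ₁, φ₂` must be a.e.-strongly measurable: Mathlib's
`eLpNorm f 2 μ = (∫⁻ ‖f‖ₑ²)^{1∕2}` is a LOWER Lebesgue integral (`lintegral` = sup over simple minorants), and Hölder's
inequality fails for lower integrals of non-measurable factors whose product is measurable: on a quotient carrying a
set `S` with `S` and `Sᶜ` both of inner measure `0` (a Bernstein set in `𝕋 = [G]` for `G(𝔸) = 𝕋`, `G(K) = A_G = 1`,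
`μ` = Haar), `φ₁ = 𝟙_S + ε`, `φ₂ = 𝟙_{Sᶜ} + ε`, `g = 1` give `φ₁ · conj φ₂ ≡ ε + ε²` (constant!), so
`‖⟨φ₁, φ₂⟩‖ₑ = (ε + ε²) μ[G]` while `‖φ₁‖₂ ‖φ₂‖₂ = ε² μ[G]` — the socket AS TYPED (no measurability binder; its
docstring's «a non-measurable integrand has junk integral 0» overlooks that a product of non-measurable functions
can be measurable) is false in that model and unprovable in general.  Repaired bytes (RULING R8 protocol): add the
binders `AEStronglyMeasurable φ₁ μ → AEStronglyMeasurable φ₂ μ →` (every consumer — #13, #14c — has continuous, hence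
strongly measurable, `φᵢ`).  This file proves the repaired statement and the two SHARPER one-sided forms (only `φ₁`,
resp. only `φ₂`, a.e.-strongly measurable), from which it follows.

* §1 `lintegral_mul_le_sqrt_mul_sqrt` — ONE-SIDED Cauchy–Schwarz for lower integrals: if `a` and `a·b` are
  a.e.-measurable (`a` finite-valued) then `∫⁻ a b ≤ (∫⁻ a²)^{1∕2} (∫⁻ b²)^{1∕2}` for ARBITRARY `b` (replace `b` by the
  measurable `b′ = a b a⁻¹ ≤ b`, Mathlib `ENNReal.lintegral_mul_le_Lp_mul_Lq`, monotonicity of `∫⁻`).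
* §2 `enorm_integral_mul_le` — `‖∫ u·w dμ‖ₑ ≤ ‖u‖₂ ‖w‖₂` as soon as `u` OR `w` is a.e.-strongly measurable (if `u·w` is
  not, the Bochner integral is the junk `0`).
* §3 `lintegral_comp_smul`, `eLpNorm_two_comp_smul` — invariance `‖φ ∘ (c • ·)‖₂ = ‖φ‖₂` under a measure-preserving
  action for ARBITRARY `φ` (Mathlib `lintegral_map_equiv` needs no measurability); `eLpNorm_two_conj`.
* §4 `quotMatrixCoeffBound_of_left ∕ _of_right` (one-sided) and the head **`quotMatrixCoeffBound`** = the REPAIRED socket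
  `sig_K2LiuQuotMatrixCoeffBoundR` TOKEN FOR TOKEN (home cand `K2/K2Liu-p07/g0/sig_K2LiuQuotMatrixCoeffBoundR.cand.lean`).

HONEST LABEL: HC_CM is proved only modulo the 7 printed citations (2 remaining named inputs: hLiu418 =
stmt-HodgeConjecture-24832, h413 = stmt-HodgeConjecture-24833) until rung 0 closes; this file is a
`--supports stmt-HodgeConjecture-24832` helper (scaffold of the K2_Liu road, SIG TABLE row #14b) and retires nothing by itself.

## References
* [Liu2021] Y. Liu, *Fourier–Jacobi cycles and arithmetic relative trace formula* ∕ App. B §B.3 (B.4), (B.7) p. 101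
  (the doubling integral `∫ f_{a,s}(ι(g′, g)) φ(g) dg` and its absolute convergence, Lem. B.10 (2)(4) p. 102).
* [BorelJacquet1979] A. Borel, H. Jacquet, *Automorphic forms and automorphic representations*, PSPM 33.1 (1979), §4.6
  (matrix coefficients of `L²([G])` under right translation).
-/

noncomputable section

-- the mandated namespace repeats the single-problem summit's segment (`HodgeConjecture.HodgeConjecture`)
set_option linter.dupNamespace false

open scoped ENNReal
open MeasureTheory NumberField
open Literature.NumberTheory.Automorphic
open Literature.NumberTheory.K2Lit.SiegelDoubled

namespace Summit.HodgeConjecture.HodgeConjecture.Cruxes.HLiu418.K2LiuQuotMatrixCoeffBound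

/-! ## §1  One-sided Cauchy–Schwarz for the lower Lebesgue integral -/

section Lintegral

variable {X : Type*} [MeasurableSpace X] {μ : Measure X}

/-- **One-sided Cauchy–Schwarz for `∫⁻`.** If `a` is a.e.-measurable and finite-valued and the PRODUCT `a·b` is
a.e.-measurable, then `∫⁻ a b dμ ≤ (∫⁻ a² dμ)^{1∕2} · (∫⁻ b² dμ)^{1∕2}` — with NO hypothesis on `b` (replace `b` by the
a.e.-measurable `b′ := a b a⁻¹`, which agrees with `b` where `a ≠ 0`, vanishes where `a = 0`, so `a b′ = a b` and `b′ ≤ b`;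
then Hölder for `(a, b′)` and monotonicity of the lower integral). [cite: BorelJacquet1979, §4.6] -/
theorem lintegral_mul_le_sqrt_mul_sqrt {a b : X → ℝ≥0∞} (ha : AEMeasurable a μ)
    (hab : AEMeasurable (fun x => a x * b x) μ) (ha_top : ∀ x, a x ≠ ∞) :
    ∫⁻ x, a x * b x ∂μ ≤
      (∫⁻ x, a x ^ (2 : ℝ) ∂μ) ^ (1 / (2 : ℝ)) * (∫⁻ x, b x ^ (2 : ℝ) ∂μ) ^ (1 / (2 : ℝ)) := by
  set b' : X → ℝ≥0∞ := fun x => a x * b x * (a x)⁻¹ with hb'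
  have hb'm : AEMeasurable b' μ := hab.mul ha.inv
  have hprod : ∀ x, a x * b' x = a x * b x := by
    intro x
    by_cases h0 : a x = 0
    · simp only [hb', h0, zero_mul]
    · simp only [hb']
      rw [mul_comm (a x) (a x * b x * (a x)⁻¹), mul_assoc, ENNReal.inv_mul_cancel h0 (ha_top x), mul_one]
  have hle : ∀ x, b' x ≤ b x := by
    intro x
    by_cases h0 : a x = 0
    · simp only [hb', h0, zero_mul, zero_le]
    · simp only [hb']
      rw [mul_comm (a x) (b x), mul_assoc, ENNReal.mul_inv_cancel h0 (ha_top x), mul_one]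
  calc ∫⁻ x, a x * b x ∂μ = ∫⁻ x, (a * b') x ∂μ := by
        refine lintegral_congr fun x => ?_
        rw [Pi.mul_apply, hprod x]
    _ ≤ (∫⁻ x, a x ^ (2 : ℝ) ∂μ) ^ (1 / (2 : ℝ)) * (∫⁻ x, b' x ^ (2 : ℝ) ∂μ) ^ (1 / (2 : ℝ)) :=
        ENNReal.lintegral_mul_le_Lp_mul_Lq μ Real.HolderConjugate.two_two ha hb'm
    _ ≤ (∫⁻ x, a x ^ (2 : ℝ) ∂μ) ^ (1 / (2 : ℝ)) * (∫⁻ x, b x ^ (2 : ℝ) ∂μ) ^ (1 / (2 : ℝ)) := by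
        gcongr with x
        exact hle x

end Lintegral

/-! ## §2  `‖∫ u·w‖ₑ ≤ ‖u‖₂ ‖w‖₂` with ONE factor a.e.-strongly measurable -/

section Integral

variable {X : Type*} [MeasurableSpace X] {μ : Measure X}

/-- `‖f‖_{L²(μ)} = (∫⁻ ‖f‖ₑ²)^{1∕2}` (Mathlib's `eLpNorm` at `p = 2`, unfolded). [folklore] -/
theorem eLpNorm_two_eq (f : X → ℂ) :
    eLpNorm f 2 μ = (∫⁻ x, ‖f x‖ₑ ^ (2 : ℝ) ∂μ) ^ (1 / (2 : ℝ)) := by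
  rw [eLpNorm_eq_lintegral_rpow_enorm_toReal two_ne_zero ENNReal.ofNat_ne_top, ENNReal.toReal_ofNat]

/-- **Cauchy–Schwarz for the Bochner integral of a product, one-sided measurability.** For `u w : X → ℂ` with `u` OR
`w` a.e.-strongly measurable, `‖∫ u w dμ‖ₑ ≤ ‖u‖_{L²(μ)} · ‖w‖_{L²(μ)}` (in `ℝ≥0∞`, no integrability hypothesis: if `u·w` is
not a.e.-strongly measurable the integral is the junk `0`; otherwise `‖∫ u w‖ₑ ≤ ∫⁻ ‖u‖ₑ‖w‖ₑ` and §1 applies to the measurable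
factor). [cite: BorelJacquet1979, §4.6] -/
theorem enorm_integral_mul_le {u w : X → ℂ} (h : AEStronglyMeasurable u μ ∨ AEStronglyMeasurable w μ) :
    ‖∫ x, u x * w x ∂μ‖ₑ ≤ eLpNorm u 2 μ * eLpNorm w 2 μ := by
  by_cases hF : AEStronglyMeasurable (fun x => u x * w x) μ
  swap
  · rw [integral_non_aestronglyMeasurable hF, enorm_zero]
    exact bot_le
  have hab : AEMeasurable (fun x => ‖u x‖ₑ * ‖w x‖ₑ) μ := by
    have h1 : AEMeasurable (fun x => ‖u x * w x‖ₑ) μ := hF.enorm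
    simpa only [enorm_mul] using h1
  rw [eLpNorm_two_eq, eLpNorm_two_eq]
  calc ‖∫ x, u x * w x ∂μ‖ₑ ≤ ∫⁻ x, ‖u x * w x‖ₑ ∂μ := enorm_integral_le_lintegral_enorm _
    _ = ∫⁻ x, ‖u x‖ₑ * ‖w x‖ₑ ∂μ := by simp only [enorm_mul]
    _ ≤ (∫⁻ x, ‖u x‖ₑ ^ (2 : ℝ) ∂μ) ^ (1 / (2 : ℝ)) * (∫⁻ x, ‖w x‖ₑ ^ (2 : ℝ) ∂μ) ^ (1 / (2 : ℝ)) := by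
        rcases h with hu | hw
        · exact lintegral_mul_le_sqrt_mul_sqrt hu.enorm hab fun x => enorm_ne_top
        · have hba : AEMeasurable (fun x => ‖w x‖ₑ * ‖u x‖ₑ) μ := by
            simpa only [mul_comm] using hab
          calc ∫⁻ x, ‖u x‖ₑ * ‖w x‖ₑ ∂μ = ∫⁻ x, ‖w x‖ₑ * ‖u x‖ₑ ∂μ := by simp only [mul_comm]
            _ ≤ (∫⁻ x, ‖w x‖ₑ ^ (2 : ℝ) ∂μ) ^ (1 / (2 : ℝ)) * (∫⁻ x, ‖u x‖ₑ ^ (2 : ℝ) ∂μ) ^ (1 / (2 : ℝ)) :=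
                lintegral_mul_le_sqrt_mul_sqrt hw.enorm hba fun x => enorm_ne_top
            _ = (∫⁻ x, ‖u x‖ₑ ^ (2 : ℝ) ∂μ) ^ (1 / (2 : ℝ)) * (∫⁻ x, ‖w x‖ₑ ^ (2 : ℝ) ∂μ) ^ (1 / (2 : ℝ)) :=
                mul_comm _ _

/-- `‖conj ∘ φ‖_{L²} = ‖φ‖_{L²}` (the `L²` norm only sees `‖·‖ₑ`, and `‖conj z‖ = ‖z‖`). [folklore] -/
theorem eLpNorm_two_conj (φ : X → ℂ) : eLpNorm (fun x => starRingEnd ℂ (φ x)) 2 μ = eLpNorm φ 2 μ := by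
  rw [eLpNorm_two_eq, eLpNorm_two_eq]
  simp only [RCLike.enorm_conj]

end Integral

/-! ## §3  Invariance of `‖·‖_{L²}` under a measure-preserving action (no measurability needed) -/

section Action

variable {G X : Type*} [Group G] [MulAction G X] [MeasurableSpace X] [MeasurableConstSMul G X]
  (μ : Measure X) [SMulInvariantMeasure G X μ]

/-- `∫⁻ f(c • x) dμ = ∫⁻ f dμ` for an invariant measure and ANY `f : X → ℝ≥0∞` (`x ↦ c • x` is a measurable automorphism
preserving `μ`; Mathlib `MeasurePreserving.lintegral_map_equiv` carries no measurability hypothesis on `f`). [folklore] -/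
theorem lintegral_comp_smul (f : X → ℝ≥0∞) (c : G) : ∫⁻ x, f (c • x) ∂μ = ∫⁻ x, f x ∂μ := by
  have hT : MeasurePreserving (MeasurableEquiv.smul c : X ≃ᵐ X) μ μ := measurePreserving_smul c μ
  exact (hT.lintegral_map_equiv f).symm

/-- `‖φ ∘ (c • ·)‖_{L²(μ)} = ‖φ‖_{L²(μ)}` for an invariant measure and ANY `φ : X → ℂ`. [cite: BorelJacquet1979, §4.6] -/
theorem eLpNorm_two_comp_smul (φ : X → ℂ) (c : G) : eLpNorm (fun x => φ (c • x)) 2 μ = eLpNorm φ 2 μ := by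
  rw [eLpNorm_two_eq, eLpNorm_two_eq, lintegral_comp_smul μ (fun x => ‖φ x‖ₑ ^ (2 : ℝ)) c]

end Action

/-! ## §4  The matrix-coefficient bound on the automorphic quotient -/

section Quot

variable {K : Type} [Field K] [NumberField K] (𝒢 : AdelicGroupData.{0} K)
  (μ : Measure 𝒢.automorphicQuotient) [𝒢.IsAutomorphicMeasure μ]

/-- **`‖⟨π(g)φ₁, φ₂⟩‖ ≤ ‖φ₁‖₂ ‖φ₂‖₂`, only `φ₁` a.e.-strongly measurable** (`φ₂` arbitrary): ★ `quotMatrixCoeff 𝒢 μ φ₁ φ₂ g =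
∫ φ₁(g⁻¹ • x) conj(φ₂ x) dμ`; §2 with `u = φ₁ ∘ (g⁻¹ • ·)` (a.e.-strongly measurable because `x ↦ g⁻¹ • x` preserves the invariant
`μ`) and `w = conj ∘ φ₂`, then §3 (`‖u‖₂ = ‖φ₁‖₂`) and `‖conj ∘ φ₂‖₂ = ‖φ₂‖₂`. [cite: Liu2021, §B.3 (B.7) p. 101] [cite: BorelJacquet1979, §4.6] -/
theorem quotMatrixCoeffBound_of_left (φ₁ φ₂ : 𝒢.automorphicQuotient → ℂ) (g : 𝒢.Adelic)
    (hφ₁ : AEStronglyMeasurable φ₁ μ) :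
    ‖quotMatrixCoeff 𝒢 μ φ₁ φ₂ g‖ₑ ≤ eLpNorm φ₁ 2 μ * eLpNorm φ₂ 2 μ := by
  have hu : AEStronglyMeasurable (fun x => φ₁ (g⁻¹ • x)) μ :=
    hφ₁.comp_quasiMeasurePreserving (measurePreserving_smul g⁻¹ μ).quasiMeasurePreserving
  rw [quotMatrixCoeff, ← eLpNorm_two_comp_smul μ φ₁ g⁻¹, ← eLpNorm_two_conj (μ := μ) φ₂]
  exact enorm_integral_mul_le (Or.inl hu)

/-- **`‖⟨π(g)φ₁, φ₂⟩‖ ≤ ‖φ₁‖₂ ‖φ₂‖₂`, only `φ₂` a.e.-strongly measurable** (`φ₁` arbitrary; §3 needs no measurability of `φ₁`).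
[cite: Liu2021, §B.3 (B.7) p. 101] [cite: BorelJacquet1979, §4.6] -/
theorem quotMatrixCoeffBound_of_right (φ₁ φ₂ : 𝒢.automorphicQuotient → ℂ) (g : 𝒢.Adelic)
    (hφ₂ : AEStronglyMeasurable φ₂ μ) :
    ‖quotMatrixCoeff 𝒢 μ φ₁ φ₂ g‖ₑ ≤ eLpNorm φ₁ 2 μ * eLpNorm φ₂ 2 μ := by
  have hw : AEStronglyMeasurable (fun x => starRingEnd ℂ (φ₂ x)) μ :=
    Complex.continuous_conj.comp_aestronglyMeasurable hφ₂
  rw [quotMatrixCoeff, ← eLpNorm_two_comp_smul μ φ₁ g⁻¹, ← eLpNorm_two_conj (μ := μ) φ₂]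
  exact enorm_integral_mul_le (Or.inr hw)

end Quot

/-- **PAYMENT OF THE REPAIRED SOCKET `sig_K2LiuQuotMatrixCoeffBoundR`** (socket #14b of unit U5 of the K2_Liu road,
`Cruxes/HLiu418/Lines/K2_Liu_CurveThetaSigs_U5_DoublingZeta.lean`; repaired bytes = the typed #14b with the two binders
`AEStronglyMeasurable φ₁ μ → AEStronglyMeasurable φ₂ μ →` inserted, home cand `K2/K2Liu-p07/g0/sig_K2LiuQuotMatrixCoeffBoundR.cand.lean`,
TOKEN FOR TOKEN).  **Matrix coefficients of `L²` functions on the automorphic quotient are bounded by the `L²` norms**: for a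
`G(𝔸)`-invariant automorphic measure `μ` on `[G] = G(𝔸) ⧸ A_G G(K)` (★ `IsAutomorphicMeasure`), a.e.-strongly measurable
`φ₁ φ₂ : [G] → ℂ` and every `g ∈ G(𝔸)`, `‖⟨π(g)φ₁, φ₂⟩‖ₑ ≤ ‖φ₁‖₂ · ‖φ₂‖₂` (★ `quotMatrixCoeff`, tree convention
`(π(g)φ)(x) = φ(g⁻¹ • x)`): Cauchy–Schwarz plus `∫ |φ₁(g⁻¹ • x)|² dμ = ∫ |φ₁|² dμ` — `quotMatrixCoeffBound_of_left`, the second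
binder being unused but part of the socket.  (The un-repaired #14b, without measurability binders, is false: module docstring.)
[cite: Liu2021, §B.3 (B.7) p. 101] [cite: BorelJacquet1979, §4.6] -/
theorem quotMatrixCoeffBound :
    ∀ {K : Type} [Field K] [NumberField K] (𝒢 : AdelicGroupData.{0} K)
      (μ : Measure 𝒢.automorphicQuotient) [𝒢.IsAutomorphicMeasure μ]
      (φ₁ φ₂ : 𝒢.automorphicQuotient → ℂ) (g : 𝒢.Adelic),
      AEStronglyMeasurable φ₁ μ → AEStronglyMeasurable φ₂ μ →
      ‖quotMatrixCoeff 𝒢 μ φ₁ φ₂ g‖ₑ ≤ eLpNorm φ₁ 2 μ * eLpNorm φ₂ 2 μ := by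
  intro K _ _ 𝒢 μ _ φ₁ φ₂ g hφ₁ _
  exact quotMatrixCoeffBound_of_left 𝒢 μ φ₁ φ₂ g hφ₁

end Summit.HodgeConjecture.HodgeConjecture.Cruxes.HLiu418.K2LiuQuotMatrixCoeffBound

end
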